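/- Free-seat work of EXTRA WIDTH SEAT `ym-line-cbag-p1-w5` (prover-ym-line-cbag-p1-w5-g3-0), route `EguchiKawaiDirectionLadder`
(ideator ym-idea-2, LINE 8), crux `TripleSmallBallMargin` (stmt-QuantumFields-27724), v7 S10-C prefab (B) asked by the LEAD:
BLOCK PHASES — for a labelling of `Fin N` and a block given by a predicate `p` (a finset `S`, enumerated increasingly by
`ι = S.orderEmbOfFin h : Fin n → Fin N`), an equivalence `e : {i // p i} ≃ Fin n` whose inverse is `ι`, under which the compressed
diagonal phase matrix `(diagonal d).toBlock p p` re-indexes to `diagonal (d ∘ ι)` (unit-modulus phases again), and the weighted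
entry sums `Σ |d_i − d_j|² |B_ij|²` over the block re-index to the same sums over `Fin n` — the inputs of the rank-robust entrywise
rigidity bound `haar_rankRobustRigidity_le` (stated on `UN n` with phases `Fin n → ℂ`) via the Haar transport `…HaarReindex`.
Pure bookkeeping, ROUTE-INDEPENDENT.  Nothing here bears on the Yang–Mills mass gap. -/
import Mathlib.Analysis.Complex.Basic
import Mathlib.Algebra.Order.BigOperators.Group.Finset
import Mathlib.Data.Finset.Sort
import Mathlib.Data.Matrix.Block
import Mathlib.LinearAlgebra.Matrix.Reindex
import HarnessLib

/-!
# Route `EguchiKawaiDirectionLadder`: block phases and block re-indexing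

* `exists_equiv_symm_eq_orderEmbOfFin` — for a finset `S` of `Fin N` with `S.card = n` and a predicate `p ↔ (· ∈ S)` there is
  `e : {i // p i} ≃ Fin n` with `(e.symm a : Fin N) = S.orderEmbOfFin h a`; block form `exists_blockEquiv` for `p = (ℓ · = c)`;
* `toBlock_diagonal` — `(diagonal d).toBlock p p = diagonal (fun i => d i)`; `reindex_toBlock_diagonal`, `reindex_diagonal_subtype` —
  along such an `e` they re-index to `diagonal (d ∘ ι)`; `norm_comp_eq_one` — the block phases are unit-modulus;
* `sum_sum_subtype_eq_sum_sum_reindex` — `Σ_{i,j : {p}} F i j (B i j) = Σ_{a,b : Fin n} F (ι a) (ι b) ((reindex e e B) a b)`, with the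
  weighted instance `sum_sum_weight_norm_sq_eq_reindex` (`F i j z = |d_i − d_j|²·|z|²`);
* `sum_sum_subtype_le` — block sums are sub-sums: `Σ_{i,j : {p}} g i j ≤ Σ_{i,j} g i j` for `g ≥ 0` (`toBlock_apply_val`).

HONEST FRAMING: bookkeeping only.  The route bears on the barrier-ledger fact `EguchiKawaiBreakdown`; the Yang–Mills mass gap is
NOT touched.
-/

set_option autoImplicit false

open Finset

namespace Summit.QuantumFields.YangMills.Theorems.EguchiKawaiDirectionLadder

namespace BlockPhases

variable {N : ℕ}

/-! ### §1 The block equivalence `{i // p i} ≃ Fin n` with inverse the increasing enumeration -/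

/-- For a finset `S ⊆ Fin N` of size `n` and a predicate `p` describing membership in `S` there is an equivalence
`e : {i // p i} ≃ Fin n` whose inverse is the increasing enumeration `S.orderEmbOfFin h`. -/
theorem exists_equiv_symm_eq_orderEmbOfFin (S : Finset (Fin N)) {n : ℕ} (h : S.card = n) (p : Fin N → Prop)
    (hp : ∀ i, p i ↔ i ∈ S) :
    ∃ e : {i // p i} ≃ Fin n, ∀ a : Fin n, ((e.symm a : {i // p i}) : Fin N) = S.orderEmbOfFin h a := by
  refine ⟨(Equiv.subtypeEquivRight hp).trans (S.orderIsoOfFin h).symm.toEquiv, fun a => ?_⟩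
  simp only [Equiv.symm_trans_apply, Equiv.subtypeEquivRight_symm_apply_coe]
  change (((S.orderIsoOfFin h) a : S) : Fin N) = S.orderEmbOfFin h a
  exact S.coe_orderIsoOfFin_apply h a

/-- **Block form**: for a labelling `ℓ : Fin N → L` and a label `c`, with `S_c = {i | ℓ i = c}` of size `n`, there is
`e : {i // ℓ i = c} ≃ Fin n` with inverse the increasing enumeration of `S_c`. -/
theorem exists_blockEquiv {L : Type*} [DecidableEq L] (ℓ : Fin N → L) (c : L) {n : ℕ}
    (h : (univ.filter fun i => ℓ i = c).card = n) :
    ∃ e : {i // ℓ i = c} ≃ Fin n, ∀ a : Fin n,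
      ((e.symm a : {i // ℓ i = c}) : Fin N) = (univ.filter fun i => ℓ i = c).orderEmbOfFin h a :=
  exists_equiv_symm_eq_orderEmbOfFin _ h _ fun i => by simp

/-- Along such an `e` the enumeration is injective and determined by `e`: `ι a = ι b → a = b`. -/
theorem injective_of_symm_eq {n : ℕ} {p : Fin N → Prop} (e : {i // p i} ≃ Fin n) (ι : Fin n → Fin N)
    (he : ∀ a, ((e.symm a : {i // p i}) : Fin N) = ι a) : Function.Injective ι := by
  intro a b hab
  rw [← he a, ← he b] at hab
  exact e.symm.injective (Subtype.ext hab)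

/-- The value of `e i` is recovered by `ι`: `ι (e i) = i`. -/
theorem apply_eq_val {n : ℕ} {p : Fin N → Prop} (e : {i // p i} ≃ Fin n) (ι : Fin n → Fin N)
    (he : ∀ a, ((e.symm a : {i // p i}) : Fin N) = ι a) (i : {i // p i}) : ι (e i) = (i : Fin N) := by
  rw [← he (e i), Equiv.symm_apply_apply]

/-! ### §2 Diagonal phase matrices on a block -/

/-- Entries of a compressed matrix: `(M.toBlock p q) i j = M i j`. -/
theorem toBlock_apply_val {α : Type*} (M : Matrix (Fin N) (Fin N) α) (p q : Fin N → Prop) (i : {i // p i}) (j : {j // q j}) :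
    M.toBlock p q i j = M (i : Fin N) (j : Fin N) := rfl

/-- The diagonal compression of a diagonal matrix is the diagonal matrix of the restricted entries. -/
theorem toBlock_diagonal (d : Fin N → ℂ) (p : Fin N → Prop) :
    (Matrix.diagonal d).toBlock p p = Matrix.diagonal fun i : {i // p i} => d i := by
  ext i j
  simp only [Matrix.toBlock_apply, Matrix.diagonal_apply]
  by_cases hij : i = j
  · subst hij; simp
  · have hij' : (i : Fin N) ≠ (j : Fin N) := fun hh => hij (Subtype.ext hh)
    simp [hij, hij']

/-- Re-indexing a diagonal matrix over the block along `e` gives the diagonal matrix of the enumerated entries. -/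
theorem reindex_diagonal_subtype {n : ℕ} {p : Fin N → Prop} (u : {i // p i} → ℂ) (e : {i // p i} ≃ Fin n) :
    Matrix.reindex e e (Matrix.diagonal u) = Matrix.diagonal (u ∘ e.symm) :=
  Matrix.submatrix_diagonal_equiv u e.symm

/-- **Block phases**: `reindex e e ((diagonal d).toBlock p p) = diagonal (d ∘ ι)` when `e.symm = ι` on values. -/
theorem reindex_toBlock_diagonal {n : ℕ} {p : Fin N → Prop} (d : Fin N → ℂ) (e : {i // p i} ≃ Fin n) (ι : Fin n → Fin N)
    (he : ∀ a, ((e.symm a : {i // p i}) : Fin N) = ι a) :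
    Matrix.reindex e e ((Matrix.diagonal d).toBlock p p) = Matrix.diagonal (d ∘ ι) := by
  rw [toBlock_diagonal, reindex_diagonal_subtype]
  congr 1
  funext a
  simp only [Function.comp_apply, he a]

/-- The same for the diagonal matrix written directly on the block type. -/
theorem reindex_diagonal_val {n : ℕ} {p : Fin N → Prop} (d : Fin N → ℂ) (e : {i // p i} ≃ Fin n) (ι : Fin n → Fin N)
    (he : ∀ a, ((e.symm a : {i // p i}) : Fin N) = ι a) :
    Matrix.reindex e e (Matrix.diagonal fun i : {i // p i} => d i) = Matrix.diagonal (d ∘ ι) := by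
  rw [← toBlock_diagonal]; exact reindex_toBlock_diagonal d e ι he

/-- Block phases are unit-modulus if the phases are. -/
theorem norm_comp_eq_one {n : ℕ} (d : Fin N → ℂ) (hd : ∀ i, ‖d i‖ = 1) (ι : Fin n → Fin N) : ∀ a, ‖(d ∘ ι) a‖ = 1 :=
  fun a => hd (ι a)

/-! ### §3 Weighted entry sums over a block -/

/-- **Entrywise sums over the block re-index to `Fin n`**:
`Σ_{i,j : {p}} F i j (B i j) = Σ_{a,b : Fin n} F (ι a) (ι b) ((reindex e e B) a b)`. -/
theorem sum_sum_subtype_eq_sum_sum_reindex {n : ℕ} {p : Fin N → Prop} [DecidablePred p] {M : Type*} [AddCommMonoid M]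
    (F : Fin N → Fin N → ℂ → M) (B : Matrix {i // p i} {i // p i} ℂ) (e : {i // p i} ≃ Fin n) (ι : Fin n → Fin N)
    (he : ∀ a, ((e.symm a : {i // p i}) : Fin N) = ι a) :
    ∑ i : {i // p i}, ∑ j : {i // p i}, F i j (B i j) = ∑ a : Fin n, ∑ b : Fin n, F (ι a) (ι b) (Matrix.reindex e e B a b) := by
  rw [← e.symm.sum_comp]
  refine sum_congr rfl fun a _ => ?_
  rw [← e.symm.sum_comp]
  refine sum_congr rfl fun b _ => ?_
  simp only [Matrix.reindex_apply, Matrix.submatrix_apply, he]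

/-- **The rigidity weights**: `Σ_{i,j : {p}} |d_i − d_j|²·|B_ij|² = Σ_{a,b : Fin n} |d(ι a) − d(ι b)|²·|(reindex e e B)_{ab}|²`. -/
theorem sum_sum_weight_norm_sq_eq_reindex {n : ℕ} {p : Fin N → Prop} [DecidablePred p] (d : Fin N → ℂ)
    (B : Matrix {i // p i} {i // p i} ℂ) (e : {i // p i} ≃ Fin n) (ι : Fin n → Fin N)
    (he : ∀ a, ((e.symm a : {i // p i}) : Fin N) = ι a) :
    ∑ i : {i // p i}, ∑ j : {i // p i}, ‖d i - d j‖ ^ 2 * ‖B i j‖ ^ 2 =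
      ∑ a : Fin n, ∑ b : Fin n, ‖(d ∘ ι) a - (d ∘ ι) b‖ ^ 2 * ‖Matrix.reindex e e B a b‖ ^ 2 :=
  sum_sum_subtype_eq_sum_sum_reindex (fun i j z => ‖d i - d j‖ ^ 2 * ‖z‖ ^ 2) B e ι he

/-- Plain Frobenius sums over the block re-index to `Fin n`. -/
theorem sum_sum_norm_sq_eq_reindex {n : ℕ} {p : Fin N → Prop} [DecidablePred p] (B : Matrix {i // p i} {i // p i} ℂ)
    (e : {i // p i} ≃ Fin n) :
    ∑ i : {i // p i}, ∑ j : {i // p i}, ‖B i j‖ ^ 2 = ∑ a : Fin n, ∑ b : Fin n, ‖Matrix.reindex e e B a b‖ ^ 2 :=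
  sum_sum_subtype_eq_sum_sum_reindex (fun _ _ z => ‖z‖ ^ 2) B e (fun a => ((e.symm a : {i // p i}) : Fin N)) fun _ => rfl

/-! ### §4 Block sums are sub-sums -/

/-- A sum over a subtype of `Fin N` is the sum over the corresponding filter. -/
theorem sum_subtype_eq_sum_filter {M : Type*} [AddCommMonoid M] (p : Fin N → Prop) [DecidablePred p] (g : Fin N → M) :
    ∑ i : {i // p i}, g i = ∑ i ∈ univ.filter p, g i :=
  (sum_subtype (univ.filter p) (fun i => by simp) g).symm

/-- A non-negative sum over a subtype is at most the full sum. -/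
theorem sum_subtype_le_sum (p : Fin N → Prop) [DecidablePred p] (g : Fin N → ℝ) (hg : ∀ i, 0 ≤ g i) :
    ∑ i : {i // p i}, g i ≤ ∑ i : Fin N, g i := by
  rw [sum_subtype_eq_sum_filter]
  exact sum_le_univ_sum_of_nonneg hg

/-- **Block sums are sub-sums**: `Σ_{i,j : {p}} g i j ≤ Σ_{i,j : Fin N} g i j` for `g ≥ 0` (e.g. the within-block part of
`Σ |d_i − d_j|²|X_ij|² = ‖diag(d) X − X diag(d)‖_F²`). -/
theorem sum_sum_subtype_le (p : Fin N → Prop) [DecidablePred p] (g : Fin N → Fin N → ℝ) (hg : ∀ i j, 0 ≤ g i j) :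
    ∑ i : {i // p i}, ∑ j : {i // p i}, g i j ≤ ∑ i : Fin N, ∑ j : Fin N, g i j := by
  calc ∑ i : {i // p i}, ∑ j : {i // p i}, g i j
      ≤ ∑ i : {i // p i}, ∑ j : Fin N, g i j :=
        sum_le_sum fun i _ => sum_subtype_le_sum p (fun j => g i j) fun j => hg i j
    _ ≤ ∑ i : Fin N, ∑ j : Fin N, g i j :=
        sum_subtype_le_sum p (fun i => ∑ j : Fin N, g i j) fun i => sum_nonneg fun j _ => hg i j

/-- The within-block weighted sum of a compressed matrix is a sub-sum of the full weighted sum: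
`Σ_{i,j : {p}} |d_i − d_j|²·|(M.toBlock p p)_ij|² ≤ Σ_{i,j} |d_i − d_j|²·|M_ij|²`. -/
theorem sum_sum_weight_toBlock_le (p : Fin N → Prop) [DecidablePred p] (d : Fin N → ℂ) (M : Matrix (Fin N) (Fin N) ℂ) :
    ∑ i : {i // p i}, ∑ j : {i // p i}, ‖d i - d j‖ ^ 2 * ‖M.toBlock p p i j‖ ^ 2 ≤
      ∑ i : Fin N, ∑ j : Fin N, ‖d i - d j‖ ^ 2 * ‖M i j‖ ^ 2 :=
  sum_sum_subtype_le p (fun i j => ‖d i - d j‖ ^ 2 * ‖M i j‖ ^ 2) fun i j => by positivity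

end BlockPhases

end Summit.QuantumFields.YangMills.Theorems.EguchiKawaiDirectionLadder
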